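import Literature.NumberTheory.GelbartRogawski1991.LocalDoubledUnitarySplitMixedModel
import Literature.RepresentationTheory.HeisenbergGroup.LeraySectionGramUnipotentValue
import HarnessLib

/-!
# The Leray section at `ℓ_Δ` on the Siegel parabolic `P_Δ`, II: the generic conjugation formula and the UNIPOTENT value
# `r_Δ(h) = Γ⁻¹ ∘ unipOpPi (c ·) ∘ Γ` ([Kudla1994, Thm 3.1]; [Rangarao1993, Thm 4.1, Lemma 5.1]; [MoeglinVignerasWaldspurger1987, Chap. 2 II.6])

Topic `NumberTheory/GelbartRogawski1991`; namespace `Literature.NumberTheory.GelbartRogawski1991.UnitaryDualPair.LocalSplitting`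
(that of ★ `LocalDoubledUnitarySplitMixedModel`, whose §1 `leraySection_deltaLagrangian_apply_eq_conj_leviOpPi` — the LEVI value — this file
twins). KERNEL ONLY: theorems; no definition, no named fact, no `sorry`.

Setting of ★ `LocalDoubledUnitarySplitMixedModel` §1: a number field `F`, a finite place `v`, a symmetric non-degenerate `T₀ ∈ M_n(F)`, the
doubled local Schrödinger model `ρ^𝔻 = localSchrodinger F (n+n) (gramD F n T₀) v` on `𝒮(F_v^{n+n})`, `r` a normalised implementer section of
`ρ^𝔻` with multiplier the Leray cocycle `c^{ψ_v(½·)}_{ℓ_Δ}` of the diagonal Lagrangian `ℓ_Δ` (Rao's section at `ℓ_Δ`, [Kudla1994, §3]), `E′ ∈ Sp(𝕎^𝔻_v)`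
with an implementer `Γ`, and `h ∈ Sp(𝕎^𝔻_v)` fixing `ℓ_Δ`.

* §1 **the GENERIC conjugation formula** (`leraySection_deltaLagrangian_apply_eq_conj`): if `E′ h E′⁻¹ = g₀` fixes `ℓ_Y = 0 ⊕ F_v^{n+n}`, then for
  EVERY Leray-at-`ℓ_Y` section `r_Y` (multiplier `c^{ψ_v(½·)}_{ℓ_Y}`), `r(h) Φ = Γ⁻¹ (r_Y(g₀) (Γ Φ))` — `h` fixes `ℓ_Δ` and `E′⁻¹ℓ_Y`, two Leray
  sections agree on a common stabiliser (★ `leraySection_apply_eq_of_map_eq`), and the Leray section of `E′⁻¹ℓ_Y` is the `Γ`-conjugate of `r_Y`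
  (★ `ImplementerSection.conjBy`; the cocycle computation is ★ `lerayCocycle_conj`). This is the common trunk of the Levi value (★), the unipotent
  value (§2) and the Weyl value (brick (J1b)).
* §2 **the UNIPOTENT value** (`leraySection_deltaLagrangian_apply_eq_conj_unipOpPi`): if `E′ h E′⁻¹ = n(c) := transportSp 𝕋^𝔻_v (low c)` (`c`
  symmetric; weil-1's `(x, y) ↦ (x, y + (𝕋^𝔻_v)⁻¹ c x)`), then `r(h) Φ = Γ⁻¹ (unipOpPi (c ·) (Γ Φ))` — §1 with ★ `leraySection_apply_transportSp_low`
  (`r_Y(n(c)) = unipOpPi (c ·)`, multiplication by `ψ_v(-½⟨x, c x⟩)`).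

USE (cell hodgecm-mathlib, half A line LD2, brick (J1a) «unipotent operator twin» of LD2-plan (g3) DEALS #13; consumer: the soft road's model
junction — after the ONE conjugation `Λ′ := Λ ∘ ω^𝔻(m₀)⁻¹` the Siegel unipotents `ι(n(b))` of `U(W ⊕ −W)` act on `Λ′` by `unipOpPi (b • c_V)` with
`halfForm c_V = Res_{E/F} h_V` anisotropic, the hypothesis shape of ★ S1 `functional_apply_eq_zero_of_forall_unipOpPi_eq`).  HONEST LABEL: nothing of
[Liu2021] asserted; HC_CM is proved only modulo the 7 printed citations (2 remaining: hLiu418 = stmt-HodgeConjecture-24832, h413 =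
stmt-HodgeConjecture-24833) until rung 0 closes; count-neutral.

## References
* S. S. Kudla, Israel J. Math. 87 (1994) 361–401, §3, Thm 3.1 [Kudla1994].
* R. Ranga Rao, Pacific J. Math. 157 (1993), Lemma 3.2 (3.8) p. 351, Thm 4.1 p. 358, Lemma 5.1 p. 361 [Rangarao1993].
* C. Mœglin, M.-F. Vignéras, J.-L. Waldspurger, LNM 1291 (1987), Chap. 2 II.2, II.6 [MoeglinVignerasWaldspurger1987].
-/

set_option autoImplicit false

noncomputable section

open NumberField IsDedekindDomain MeasureTheory Matrix
open Literature.RepresentationTheory.HeisenbergGroup Literature.RepresentationTheory.HeisenbergGroup.SymplecticMatrix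
open Literature.NumberTheory.Automorphic Literature.NumberTheory.Automorphic.UnitaryGroup Literature.NumberTheory.Weil1964
open Literature.NumberTheory.GaloisRepresentations.IsNonarchimedeanLocalField
open Literature.GroupTheory Literature.LinearAlgebra.QuadraticForm

namespace Literature.NumberTheory.GelbartRogawski1991.UnitaryDualPair.LocalSplitting

variable (F : Type) [Field F] [NumberField F] (v : HeightOneSpectrum (𝓞 F))
  [MeasurableSpace (v.adicCompletion F)] [BorelSpace (v.adicCompletion F)]
  (μ : Measure (v.adicCompletion F)) [μ.IsAddHaarMeasure]
  (n : ℕ) {T₀ : Matrix (Fin n) (Fin n) F} (hT₀d : IsUnit T₀.det)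

/-! ## §1 The generic conjugation formula on `P_Δ` -/

include hT₀d in
/-- **THE GENERIC CONJUGATION FORMULA for Rao's Leray section at `ℓ_Δ`**: let `r` be a normalised implementer section of the doubled
Schrödinger model with multiplier `c^{ψ_v(½·)}_{ℓ_Δ}`, `r_Y` one with multiplier `c^{ψ_v(½·)}_{ℓ_Y}`, `E′ ∈ Sp(𝕎^𝔻_v)`, `Γ` an implementer of `E′`,
and `h ∈ Sp(𝕎^𝔻_v)` with `h ℓ_Δ = ℓ_Δ` and `E′ h E′⁻¹ = g₀`, `g₀ ℓ_Y = ℓ_Y`. Then `r(h) Φ = Γ⁻¹ (r_Y(g₀) (Γ Φ))` — `h` fixes both `ℓ_Δ` and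
`E′⁻¹ ℓ_Y`, the two Leray sections agree there, and the one of `E′⁻¹ℓ_Y` is the `Γ`-conjugate of `r_Y`.
[cite: Rangarao1993, Thm 4.1, Lemma 5.1; MoeglinVignerasWaldspurger1987, Chap. 2 II.6] -/
theorem leraySection_deltaLagrangian_apply_eq_conj
    (hU : ImplementerUniqueUpToScalar (localSchrodinger F (n + n) (gramD F n T₀) v))
    (r : ImplementerSection (localSchrodinger F (n + n) (gramD F n T₀) v))
    (hr : ∀ g₁ g₂ : LocalSp F (n + n) (gramD F n T₀) v, r.cocycle hU g₁ g₂ =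
      localLeray F (n + n) (gramD F n T₀) (isUnit_det_gramD F n hT₀d) v μ ((adeleAddCharAt F v).mulShift (⅟(2 : (v.adicCompletion F))))
        (isContinuousNontrivial_adeleAddCharAt_half F v) (deltaLagrangian F v n)
        (deltaLagrangian_orthogonal F v n T₀ hT₀d) g₁ g₂)
    (rY : ImplementerSection (localSchrodinger F (n + n) (gramD F n T₀) v))
    (hrY : ∀ g₁ g₂ : LocalSp F (n + n) (gramD F n T₀) v, rY.cocycle hU g₁ g₂ =
      localLeray F (n + n) (gramD F n T₀) (isUnit_det_gramD F n hT₀d) v μ ((adeleAddCharAt F v).mulShift (⅟(2 : (v.adicCompletion F))))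
        (isContinuousNontrivial_adeleAddCharAt_half F v) (lagrangianY F (n + n) v)
        (orthogonal_lagrangianY F (n + n) (gramD F n T₀) v (isUnit_det_gramD F n hT₀d)) g₁ g₂)
    (E' : LocalSp F (n + n) (gramD F n T₀) v) (Γ : (SchwartzBruhat (Fin (n + n) → v.adicCompletion F)) ≃ₗ[ℂ] (SchwartzBruhat (Fin (n + n) →
        v.adicCompletion F)))
    (hΓ : Implements (localSchrodinger F (n + n) (gramD F n T₀) v) (ofSymplectic _ E') Γ)
    (h : LocalSp F (n + n) (gramD F n T₀) v)
    (hh : (deltaLagrangian F v n).map (toLin F v h) = deltaLagrangian F v n)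
    (g₀ : LocalSp F (n + n) (gramD F n T₀) v) (hB : E' * h * E'⁻¹ = g₀)
    (hg₀ : (lagrangianY F (n + n) v).map (toLin F v g₀) = lagrangianY F (n + n) v)
    (Φ : (SchwartzBruhat (Fin (n + n) → v.adicCompletion F))) : r h Φ = Γ.symm (rY g₀ (Γ Φ)) := by
  have hψ := isContinuousNontrivial_adeleAddCharAt F v
  have hTK := isUnit_det_localGram_gramD F v n hT₀d
  haveI : Nontrivial (SchwartzBruhat (Fin (n + n) → v.adicCompletion F)) := nontrivial_schwartzBruhat_pi
  haveI : CharZero (v.adicCompletion F) := charZero_of_injective_algebraMap (algebraMap F (v.adicCompletion F)).injective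
  have hrY' : rY.cocycle hU = lerayCentralCocycle μ (isContinuousNontrivial_mulShift_half hψ)
      (isAlt_alt_polar_gram (localGram F (n + n) (gramD F n T₀) v))
      (nondegenerate_alt_polar_gram (localGram F (n + n) (gramD F n T₀) v) hTK)
      (orthogonal_lagrangianY F (n + n) (gramD F n T₀) v (isUnit_det_gramD F n hT₀d)) :=
    CentralCocycle.ext fun g₁ g₂ => hrY g₁ g₂
  have hr' : r.cocycle hU = lerayCentralCocycle μ (isContinuousNontrivial_mulShift_half hψ)
      (isAlt_alt_polar_gram (localGram F (n + n) (gramD F n T₀) v))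
      (nondegenerate_alt_polar_gram (localGram F (n + n) (gramD F n T₀) v) hTK)
      (deltaLagrangian_orthogonal F v n T₀ hT₀d) :=
    CentralCocycle.ext fun g₁ g₂ => hr g₁ g₂
  -- the `Γ`-conjugated section: Leray-normalised at `E⁻¹ ℓ_Y`
  set r₂ := rY.conjBy E' Γ hΓ with hr₂_def
  have hℓ₂ : LinearMap.BilinForm.orthogonal (alt (polar (localPairing F (n + n) (gramD F n T₀) v)))
      ((lagrangianY F (n + n) v).map (toLin F v E'⁻¹)) = (lagrangianY F (n + n) v).map (toLin F v E'⁻¹) :=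
    orthogonal_map_symplectic_eq_self (nondegenerate_alt_polar F (n + n) (gramD F n T₀) v (isUnit_det_gramD F n hT₀d))
      (orthogonal_lagrangianY F (n + n) (gramD F n T₀) v (isUnit_det_gramD F n hT₀d)) E'⁻¹
  have hr₂ : r₂.cocycle hU = lerayCentralCocycle μ (isContinuousNontrivial_mulShift_half hψ)
      (isAlt_alt_polar_gram (localGram F (n + n) (gramD F n T₀) v))
      (nondegenerate_alt_polar_gram (localGram F (n + n) (gramD F n T₀) v) hTK) hℓ₂ := by
    refine CentralCocycle.ext fun g₁ g₂ => Units.ext ?_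
    rw [hr₂_def, ImplementerSection.cocycle_conjBy rY hU E' Γ hΓ, hrY']
    change lerayCocycle ((adeleAddCharAt F v).mulShift (⅟(2 : (v.adicCompletion F)))) μ (alt (polar (localPairing F (n + n) (gramD F n T₀) v)))
        (lagrangianY F (n + n) v) ((E' * g₁ * E'⁻¹ : LocalSp F (n + n) (gramD F n T₀) v) : _ ≃ₗ[(v.adicCompletion F)] _)
        ((E' * g₂ * E'⁻¹ : LocalSp F (n + n) (gramD F n T₀) v) : _ ≃ₗ[(v.adicCompletion F)] _) =
      lerayCocycle ((adeleAddCharAt F v).mulShift (⅟(2 : (v.adicCompletion F)))) μ (alt (polar (localPairing F (n + n) (gramD F n T₀) v)))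
        ((lagrangianY F (n + n) v).map (toLin F v E'⁻¹)) (g₁ : _ ≃ₗ[(v.adicCompletion F)] _) (g₂ : _ ≃ₗ[(v.adicCompletion F)] _)
    -- `c_{ℓ_Y}(E g₁ E⁻¹, E g₂ E⁻¹) = c_{E⁻¹ℓ_Y}(g₁, g₂)`
    have key := lerayCocycle_conj μ ((E'⁻¹ : LocalSp F (n + n) (gramD F n T₀) v) : ((Fin (n + n) → v.adicCompletion F) × (Fin (n + n) →
        v.adicCompletion F)) ≃ₗ[(v.adicCompletion F)] ((Fin (n + n) → v.adicCompletion F) × (Fin (n + n) → v.adicCompletion F))) (E'⁻¹).2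
      (isContinuousNontrivial_mulShift_half hψ) (lagrangianY F (n + n) v)
      ((E' * g₁ * E'⁻¹ : LocalSp F (n + n) (gramD F n T₀) v) : ((Fin (n + n) → v.adicCompletion F) × (Fin (n + n) → v.adicCompletion F))
          ≃ₗ[(v.adicCompletion F)] ((Fin (n + n) → v.adicCompletion F) × (Fin (n + n) → v.adicCompletion F)))
      ((E' * g₂ * E'⁻¹ : LocalSp F (n + n) (gramD F n T₀) v) : ((Fin (n + n) → v.adicCompletion F) × (Fin (n + n) → v.adicCompletion F))
          ≃ₗ[(v.adicCompletion F)] ((Fin (n + n) → v.adicCompletion F) × (Fin (n + n) → v.adicCompletion F)))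
    have e : ∀ g : LocalSp F (n + n) (gramD F n T₀) v,
        ((E'⁻¹ : LocalSp F (n + n) (gramD F n T₀) v) : ((Fin (n + n) → v.adicCompletion F) × (Fin (n + n) → v.adicCompletion F)) ≃ₗ[(v.adicCompletion
            F)] ((Fin (n + n) → v.adicCompletion F) × (Fin (n + n) → v.adicCompletion F))).symm ≪≫ₗ
          ((E' * g * E'⁻¹ : LocalSp F (n + n) (gramD F n T₀) v) : ((Fin (n + n) → v.adicCompletion F) × (Fin (n + n) → v.adicCompletion F))
              ≃ₗ[(v.adicCompletion F)] ((Fin (n + n) → v.adicCompletion F) × (Fin (n + n) → v.adicCompletion F))) ≪≫ₗ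
          ((E'⁻¹ : LocalSp F (n + n) (gramD F n T₀) v) : ((Fin (n + n) → v.adicCompletion F) × (Fin (n + n) → v.adicCompletion F))
              ≃ₗ[(v.adicCompletion F)] ((Fin (n + n) → v.adicCompletion F) × (Fin (n + n) → v.adicCompletion F))) = ((g : LocalSp F (n + n) (gramD F
              n T₀) v) : ((Fin (n + n) → v.adicCompletion F) × (Fin (n + n) → v.adicCompletion F)) ≃ₗ[(v.adicCompletion F)] ((Fin (n + n) →
              v.adicCompletion F) × (Fin (n + n) → v.adicCompletion F))) := fun g => by
      refine LinearEquiv.ext fun x => ?_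
      simp only [LinearEquiv.trans_apply, Subgroup.coe_mul, Subgroup.coe_inv, LinearEquiv.mul_apply,
        LinearEquiv.coe_inv, LinearEquiv.symm_apply_apply]
      exact congrArg ((g : LocalSp F (n + n) (gramD F n T₀) v) : ((Fin (n + n) → v.adicCompletion F) × (Fin (n + n) → v.adicCompletion F))
          ≃ₗ[(v.adicCompletion F)] ((Fin (n + n) → v.adicCompletion F) × (Fin (n + n) → v.adicCompletion F)))
        (((E' : LocalSp F (n + n) (gramD F n T₀) v) : ((Fin (n + n) → v.adicCompletion F) × (Fin (n + n) → v.adicCompletion F)) ≃ₗ[(v.adicCompletion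
            F)] ((Fin (n + n) → v.adicCompletion F) × (Fin (n + n) → v.adicCompletion F))).symm_apply_apply x)
    rw [e, e] at key
    exact key.symm
  -- `h` fixes `E⁻¹ ℓ_Y`
  have h₂ : ((lagrangianY F (n + n) v).map (toLin F v E'⁻¹)).map (toLin F v h) =
      (lagrangianY F (n + n) v).map (toLin F v E'⁻¹) := by
    have eh : h = E'⁻¹ * (E' * h * E'⁻¹) * E' := by group
    conv_lhs => rw [eh, hB]
    rw [← map_coe_mul, mul_inv_cancel_right, map_coe_mul, hg₀]
  -- two Leray sections agree on the common stabiliser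
  have hagree := leraySection_apply_eq_of_map_eq μ
    (monoidHom_symplecticGroup_gram_eq_one (localGram F (n + n) (gramD F n T₀) v) hTK)
    (isContinuousNontrivial_mulShift_half hψ) (isAlt_alt_polar_gram (localGram F (n + n) (gramD F n T₀) v))
    (nondegenerate_alt_polar_gram (localGram F (n + n) (gramD F n T₀) v) hTK)
    (deltaLagrangian_orthogonal F v n T₀ hT₀d) hℓ₂ hU r r₂ hr' hr₂ h hh h₂
  -- the value of the conjugated section
  rw [hagree, hr₂_def, ImplementerSection.conjBy_apply, hB]

/-! ## §2 The unipotent value: `r_Δ(h) = Γ⁻¹ ∘ unipOpPi (c ·) ∘ Γ` when `E′ h E′⁻¹ = n(c)` -/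

include hT₀d in
/-- **ON THE SIEGEL PARABOLIC `P_Δ`, RAO'S LERAY SECTION AT `ℓ_Δ` IS THE CONJUGATED UNIPOTENT OPERATOR**: with `r`, `E′`, `Γ`, `h` as in §1 and
`E′ h E′⁻¹ = n(c) := transportSp 𝕋^𝔻_v (low c)` (`c ∈ M_{n+n}(F_v)` symmetric) a transported Siegel unipotent, `r(h) Φ = Γ⁻¹ (unipOpPi (c ·) (Γ Φ))`,
`(unipOpPi (c ·) Ψ)(x) = ψ_v(-½⟨x, c x⟩) Ψ(x)` — §1 and the unipotent value `r_Y(n(c)) = unipOpPi (c ·)` (★ `leraySection_apply_transportSp_low`).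
The UNIPOTENT twin of ★ `leraySection_deltaLagrangian_apply_eq_conj_leviOpPi`. [cite: Kudla1994, Thm 3.1; Rangarao1993, Lemma 3.2 (3.8), Thm 4.1, Lemma 5.1;
MoeglinVignerasWaldspurger1987, Chap. 2 II.6] -/
theorem leraySection_deltaLagrangian_apply_eq_conj_unipOpPi
    (hU : ImplementerUniqueUpToScalar (localSchrodinger F (n + n) (gramD F n T₀) v))
    (r : ImplementerSection (localSchrodinger F (n + n) (gramD F n T₀) v))
    (hr : ∀ g₁ g₂ : LocalSp F (n + n) (gramD F n T₀) v, r.cocycle hU g₁ g₂ =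
      localLeray F (n + n) (gramD F n T₀) (isUnit_det_gramD F n hT₀d) v μ ((adeleAddCharAt F v).mulShift (⅟(2 : (v.adicCompletion F))))
        (isContinuousNontrivial_adeleAddCharAt_half F v) (deltaLagrangian F v n)
        (deltaLagrangian_orthogonal F v n T₀ hT₀d) g₁ g₂)
    (E' : LocalSp F (n + n) (gramD F n T₀) v) (Γ : (SchwartzBruhat (Fin (n + n) → v.adicCompletion F)) ≃ₗ[ℂ] (SchwartzBruhat (Fin (n + n) →
        v.adicCompletion F)))
    (hΓ : Implements (localSchrodinger F (n + n) (gramD F n T₀) v) (ofSymplectic _ E') Γ)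
    (h : LocalSp F (n + n) (gramD F n T₀) v)
    (hh : (deltaLagrangian F v n).map (toLin F v h) = deltaLagrangian F v n)
    (c : Matrix (Fin (n + n)) (Fin (n + n)) (v.adicCompletion F)) (hc : c.IsSymm)
    (hB : E' * h * E'⁻¹ = transportSp (localGram F (n + n) (gramD F n T₀) v)
      (isUnit_det_localGram_gramD F v n hT₀d) (low c hc))
    (Φ : (SchwartzBruhat (Fin (n + n) → v.adicCompletion F))) :
    r h Φ = Γ.symm (unipOpPi (isLocallyConstant_of_isContinuousNontrivial (isContinuousNontrivial_adeleAddCharAt F v))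
      (Matrix.mulVecLin c) (Γ Φ)) := by
  have hψ := isContinuousNontrivial_adeleAddCharAt F v
  have hTK := isUnit_det_localGram_gramD F v n hT₀d
  haveI : CharZero (v.adicCompletion F) := charZero_of_injective_algebraMap (algebraMap F (v.adicCompletion F)).injective
  -- the Leray section at `ℓ_Y`
  obtain ⟨hU', rY, hrY⟩ := exists_leraySection_half F (n + n) (gramD F n T₀) (isUnit_det_gramD F n hT₀d) v μ
    (lagrangianY F (n + n) v) (orthogonal_lagrangianY F (n + n) (gramD F n T₀) v (isUnit_det_gramD F n hT₀d))
  have hrY' : rY.cocycle hU = lerayCentralCocycle μ (isContinuousNontrivial_mulShift_half hψ)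
      (isAlt_alt_polar_gram (localGram F (n + n) (gramD F n T₀) v))
      (nondegenerate_alt_polar_gram (localGram F (n + n) (gramD F n T₀) v) hTK)
      (orthogonal_lagrangianY F (n + n) (gramD F n T₀) v (isUnit_det_gramD F n hT₀d)) :=
    CentralCocycle.ext fun g₁ g₂ => hrY g₁ g₂
  rw [leraySection_deltaLagrangian_apply_eq_conj F v μ n hT₀d hU r hr rY hrY E' Γ hΓ h hh _ hB
      (map_transportSp_low_prod_bot_top (localGram F (n + n) (gramD F n T₀) v) hTK c hc) Φ,
    leraySection_apply_transportSp_low (localGram F (n + n) (gramD F n T₀) v) hTK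
      (isLocallyConstant_of_isContinuousNontrivial hψ) (continuous_toLinearMap₂'_left (localGram F (n + n) (gramD F n T₀) v))
      μ hψ hU rY (orthogonal_lagrangianY F (n + n) (gramD F n T₀) v (isUnit_det_gramD F n hT₀d)) hrY' c hc]

end Literature.NumberTheory.GelbartRogawski1991.UnitaryDualPair.LocalSplitting

end
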